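import Summits.BirchSwinnertonDyer.BirchSwinnertonDyer.Theorems.GenusKolyvaginAtTwoPowDvdShaCardAtTwoRTStubCtOrthogonalAtTwo
import Summits.BirchSwinnertonDyer.BirchSwinnertonDyer.Theorems.GenusKolyvaginAtTwoPowDvdShaCardAtTwoPosTCrossTermTransposition
import HarnessLib

/-!
# Route `GenusKolyvaginAtTwo`, crux L⁺_T `PowDvdShaCardAtTwoPosT` (stmt-BirchSwinnertonDyer-23379), road (E4)⁺ — stub X-ORTH⁺, FIRST OF TWO FILES:
# Cassels–Tate orthogonality of (+)- and (−)-provenance Kolyvagin Ш-classes at TRANSPOSITION-DEEP primes — the one-pair theorem and its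
# instantiation on a Kolyvagin class (sign-free twins of `…RTCrossPairProvenance` §1–§2; §3–§5 in `…PosTXOrthTransposition`)

Seat `bsd-line-gk2-p2` g22 (PROVER seat 2/3, cell `bsd-f1-sign2`), `--supports stmt-BirchSwinnertonDyer-23379` (helper; closes nothing).
THEOREMS ONLY (no definition, no named fact, no `sorry`).  BSD is NOT proved by any of this; neither is L⁺_T; (E4)⁺ still needs KS⁺ (the exact swap
engine with transposition primes) and the restated item L⁺_T′ (R9-L).

WHY (memo `Cruxes/KolyvaginExactAtTwoPosDiscT/RESTATEMENT-R9L-posdisc-lower-gk2p2.md`).  Road (E4) = capstone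
`pow_dvd_natCard_sha_of_kolyvaginSupplies_of_orthogonal_of_rank_le_one` (p741898, SIGN-FREE, prime predicates `Xp`/`Xm` free) fed by (R), KS and the
socket X-ORTH∃.  On `Δ < 0` X-ORTH∃ was closed by `ctOrthogonalAtTwo_of_frame` over gk2-p4's one-pair theorem and gk2-p5's provenance adapter, with
`Xp = Xm = FrobEqFrobInfty W K (2^L)` and `Δ < 0` entering ONLY through the regular frame at the cross places.  This file is the same chain with
the transposition frame (`…PosTTranspositionFrame`, `…PosTCrossTermTransposition`, this seat):
* §1 `ctLevelPairing_eq_zero_of_opposite_signs_of_level_eq_transposition` (one pair, `ι`-free, level free; cross places transposition-deep),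
* §2 `ctLevelPairing_eq_zero_of_kolyvaginClass_of_opposite_sign_transposition` (instantiated on a Kolyvagin class, ordered form),
* §3 `ctLevelPairing_eq_zero_of_kolyvagin_provenance_transposition` (both classes with provenance and recorded element signs),
* §4 `ctLevelPairing_hOrth_of_kolyvagin_provenance_transposition` (the capstone's `hOrth` literally, `Xp = Xm =` transposition clause),
* §5 **`ctOrthogonalAtTwo_of_frame_transposition`** — X-ORTH∃ of (E4)⁺: `∃ B` on `Ш(E_K)[2^k]` with the level-kernel clause and `hOrth` at class level
  `2^(2k)`, for EITHER sign of `Δ` (stub X-ORTH⁺ CLOSED as a theorem; it becomes a by-name stub closer once the LEAD registers an (E4)⁺ skeleton on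
  the restated L⁺_T′).
What (E4)⁺ still owes after this file: KS⁺ = `kolyvaginSuppliesAtTwo_of_…` with transposition primes (the exact swap engine: P7a⁼/P7b⁼ at a
regular place, the regular signed pair-Čebotarev = gk2-p4 g23 Parts A–C, T2, Q2), and (R⁺) on the cut (free: `…PosTOnCut.exists_frame_of_cut` ∘ B2Q⁺).

References: [McCallumLMS1991] §4 Lemma 4.3, Prop. 4.4, Prop. 4.7, §5 Lemma 5.3, Thm. 5.4; [GrossLMS1991] §3, Prop. 5.4, Prop. 6.2;
[MilneADT2006] I §6 Prop. 6.9, Lemma 6.17; [Cassels1962ArithmeticIV] §1; [Kolyvagin1991StructureSha]; [DokchitserDokchitserMathZ2012] Thm. (1).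
-/

set_option autoImplicit false

noncomputable section

open scoped Classical
open scoped AddSubgroup
open Function Field NumberField IsDedekindDomain WeierstrassCurve
open Literature.NumberTheory.EllipticCurves Literature.NumberTheory.GaloisRepresentations
open Literature.NumberTheory.EllipticCurves.ModularForms
open Literature.NumberTheory.GaloisCohomology
open Literature.NumberTheory.Automorphic
open Summit.BirchSwinnertonDyer.Rank1Residual.X11b.Relaxation
open Summit.BirchSwinnertonDyer.Rank1Residual.JET.GlobalDuality
open Summit.BirchSwinnertonDyer.Rank1Residual

-- the Theorems namespace of this sub repeats the summit name by design (D-0017 nested layout)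
set_option linter.dupNamespace false

namespace Summit.BirchSwinnertonDyer.BirchSwinnertonDyer.Theorems.GenusExact.PlusDescent

variable (W : WeierstrassCurve ℚ) (K : Type) [Field K] [NumberField K] [W.IsElliptic] [W.IsGloballyMinimal]

/-! ## §1 One pair, `ι`-free, class level free, transposition-deep cross places -/

/-- **X-ORTH FOR ONE PAIR, `ι`-free, class level `N = m·m` free — transposition-deep cross places (sign-free twin of
`ctLevelPairing_eq_zero_of_opposite_signs_of_level_eq`).**  Hypotheses verbatim except: NO `Δ < 0`, and every cross place `q ∈ Sn ∖ Sn′` is a deep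
inert Kolyvagin place (`M ≤ M(ℓ)`) whose Frobenius MOVES A POINT OF `E[2]` (in place of Gross's `FrobEqFrobInfty W K (2^M) ℓ`).  Conclusion:
`B_m(x, x′) = 0`. (Proof adapted verbatim from gk2-p5 g27 / gk2-p4 g20; the cross term is `firstCase_localTerm_eq_zero_of_cross_of_sign_inclKD_transposition`.)
[cite: McCallumLMS1991, §4 Prop. 4.7, §5 Lemma 5.3, Thm. 5.4] [cite: MilneADT2006, Ch. I §6, proof of Prop. 6.9] -/
theorem ctLevelPairing_eq_zero_of_opposite_signs_of_level_eq_transposition {m M N : ℕ} [NeZero m] [NeZero (m * m)]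
    (hNm : N = m * m) (hmm : m * m = 2 ^ M)
    (hK : IsImaginaryQuadratic K) (hM : 1 ≤ M) {τ : K ≃ₐ[ℚ] K} (hτ1 : τ ≠ 1) (hττ : τ * τ = 1)
    (e : (W.baseChange K).geomTorsion ((m * m : ℕ) : ℤ) → (W.baseChange K).geomTorsion ((m * m : ℕ) : ℤ) → AlgebraicClosure K)
    (hμ : ∀ S T, e S T ^ (m * m) = 1)
    (hadd₁ : ∀ S₁ S₂ T, e (S₁ + S₂) T = e S₁ T * e S₂ T)
    (hadd₂ : ∀ S T₁ T₂, e S (T₁ + T₂) = e S T₁ * e S T₂)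
    (hgal : ∀ (γ : absoluteGaloisGroup K) (S T : (W.baseChange K).geomTorsion ((m * m : ℕ) : ℤ)), γ • e S T = e (γ • S) (γ • T))
    (halt : ∀ T, e T T = 1)
    (inv : LocalInvariants K (m * m)) (hinvc : inv.IsConjCompatible τ) (hPT' : inv.SumInvLocalizationEqZero)
    (hH3 : ∀ c₃ : galoisCohomology (DiscreteGaloisModule.mu K (m * m)) 3,
      (∀ v : Place K, galoisCohomology.localization (DiscreteGaloisModule.mu K (m * m)) v 3 c₃ = 0) → c₃ = 0)
    (hfin : ∀ D : GeneralCaseData (W.baseChange K) m e hμ hadd₁ hadd₂ hgal, ∃ S : Finset (Place K), ∀ v ∉ S, D.localTerm inv v = 0)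
    (hnofix : ∀ P : geomTorsion (W.baseChange K) (m : ℤ), (∀ g : absoluteGaloisGroup K, g • P = P) → P = 0)
    (x x' : ((W.baseChange K).sha)[m])
    {z t : galH1Torsion (W.baseChange K) ((N : ℕ) : ℤ)}
    {c : galoisCohomology ((W.baseChange K).torsionGaloisModule ((N : ℕ) : ℤ)) 1}
    (hzS : z ∈ selmerGroup (W.baseChange K) ((N : ℕ) : ℤ)) (htS : t ∈ selmerGroup (W.baseChange K) ((N : ℕ) : ℤ))
    (hx : shaTorsionVal (W.baseChange K) m x = torsionH1ToH1 (W.baseChange K) ((N : ℕ) : ℤ) z)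
    (hx' : shaTorsionVal (W.baseChange K) m x' = torsionH1ToH1 (W.baseChange K) ((N : ℕ) : ℤ) t)
    (k : ℤ) (hz : z = (m : ℤ) • k • c) (hmt : (m : ℤ) • t = 0)
    {s : ℤ} (hsc : conjAct W τ ((N : ℕ) : ℤ) (k • c) = s • (k • c))
    (hst : conjAct W τ ((N : ℕ) : ℤ) t = -(s • t))
    (Sn Sn' : Set (HeightOneSpectrum (𝓞 K)))
    (hc : ∀ v : Place K, (∀ q ∈ Sn, v ≠ Sum.inr q) → c ∈ selmerLocalKer (W.baseChange K) (Place.Completion v) ((N : ℕ) : ℤ))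
    (hmc : ∀ q ∈ Sn, (m : ℤ) • galoisCohomology.localization ((W.baseChange K).torsionGaloisModule ((N : ℕ) : ℤ))
      (Sum.inr q : Place K) 1 (k • c) = 0)
    (ht0 : ∀ q ∈ Sn', galoisCohomology.res ((W.baseChange K).torsionGaloisModule ((N : ℕ) : ℤ))
      (Place.Completion (Sum.inr q : Place K)) 1 t = 0)
    (htriv : ∀ q ∈ Sn', ∀ (g : absoluteGaloisGroup (Place.Completion (Sum.inr q : Place K)))
      (Q : geomTorsion (W.baseChange K) ((N : ℕ) : ℤ)), absGaloisRestrict K (Place.Completion (Sum.inr q : Place K)) g • Q = Q)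
    (hcross : ∀ q ∈ Sn, q ∉ Sn' → ∃ (ℓ : ℕ) (hfix : τ • q = q), Zhang2014.IsKolyvaginPrime (W.conductorNorm ℤ) W K 2 ℓ ∧
      M ≤ Zhang2014.kolyvaginIndex W 2 ℓ ∧
        (∃ (v : HeightOneSpectrum (𝓞 ℚ)) (𝔓 : Ideal (absIntegers (𝓞 ℚ) ℚ)) (h : absoluteGaloisGroup ℚ),
          (ℓ : 𝓞 ℚ) ∈ v.asIdeal ∧ 𝔓 ∈ v.primesAbove ∧ IsArithFrobAt (𝓞 ℚ) h 𝔓 ∧ ∃ u : geomTorsion W 2, h • u ≠ u) ∧ (ℓ : 𝓞 K) ∈ q.asIdeal ∧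
      ∀ S T, e ((isLiftOfAut_liftAutPlace τ hfix).torsionMap W ((m * m : ℕ) : ℤ) S)
        ((isLiftOfAut_liftAutPlace τ hfix).torsionMap W ((m * m : ℕ) : ℤ) T) = liftAutPlace τ hfix (e S T)) :
    ctLevelPairing (W.baseChange K) m e hμ hadd₁ hadd₂ hgal inv halt hPT' hH3 hfin x x' = 0 := by
  subst hNm
  -- first-case data for the pair
  obtain ⟨D, hD₁, hDt⟩ := exists_firstCaseData_kolyvagin (⟨z, hzS⟩ : selmerGroup (W.baseChange K) ((m * m : ℕ) : ℤ))
    ⟨t, htS⟩ c k hz hnofix hmt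
  refine ctLevelPairing_eq_zero_of_forall_cases' e hμ hadd₁ hadd₂ hgal inv halt hPT' hH3 hfin x x' hx hx' hz D hD₁ hDt
    fun v ↦ ?_
  by_cases hv' : ∃ q ∈ Sn', v = Sum.inr q
  · -- own place of `t`: `loc_v b′ = 0`
    obtain ⟨q, hq, rfl⟩ := hv'
    exact Or.inr (Or.inl (D.res_b'_eq_zero_of_map_inclKD_eq hDt (ht0 q hq)
      (map_inclKD_restrictField_injective_of_forall_smul_eq (W.baseChange K) m (Place.Completion (Sum.inr q : Place K))
        (htriv q hq))))
  by_cases hv : ∃ q ∈ Sn, v = Sum.inr q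
  · -- cross place: `q ∈ Sn ∖ Sn′`
    obtain ⟨q, hq, rfl⟩ := hv
    have hq' : q ∉ Sn' := fun h ↦ hv' ⟨q, h, rfl⟩
    obtain ⟨ℓ, hfix, hℓ, hk, hF, hw, hte⟩ := hcross q hq hq'
    refine Or.inr (Or.inr ?_)
    have hb₁ : conjAct W τ ((m * m : ℕ) : ℤ) D.b₁ = s • D.b₁ := by rw [hD₁]; exact hsc
    have hmb₁ : (m : ℤ) • galoisCohomology.localization ((W.baseChange K).torsionGaloisModule ((m * m : ℕ) : ℤ))
        (Sum.inr q : Place K) 1 D.b₁ = 0 := by rw [hD₁]; exact hmc q hq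
    exact firstCase_localTerm_eq_zero_of_cross_of_sign_inclKD_transposition W K hmm hK hM hℓ hk hF q hw hτ1 hττ hfix e hμ hadd₁ hadd₂ hgal
      halt hte inv hinvc hnofix D hb₁ hmb₁ hDt hst
  · -- `b₁` is Selmer (Kummer) here
    push Not at hv hv'
    refine Or.inl ?_
    have hcv : c ∈ selmerLocalKer (W.baseChange K) (Place.Completion v) ((m * m : ℕ) : ℤ) := hc v fun q hq h ↦ hv q hq h
    rw [map_zsmul]
    exact AddSubgroup.zsmul_mem _ (mem_kummerLocalConditionAt_res_of_mem_selmerLocalKer (W.baseChange K) _ _ hcv) k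

/-! ## §2 Instantiated on a Kolyvagin class (ordered form) -/

/-- **X-ORTH INSTANTIATED ON A KOLYVAGIN CLASS, ordered form, transposition-deep primes (sign-free twin of
`ctLevelPairing_eq_zero_of_kolyvaginClass_of_opposite_sign`).**  Habitat over the Heegner field WITHOUT the sign of `Δ` (`W/ℚ` globally minimal, odd
Tamagawa product, `ρ̄_{E,2}` onto; `K` imaginary quadratic, `d_K` odd `≠ −3`, Heegner for `N_W`; `τ ≠ 1`); Cassels–Tate level `m = 2^k`, class level
`2^L`, `L = 2k`; first class `z = 2^{L−e₁} • c_L(n)` with every `ℓ ∣ n` Zhang–Kolyvagin of index `≥ L` AND OF TRANSPOSITION TYPE (Frobenius moves a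
point of `E[2]`), Selmer and own-vanishing as recorded; second class `t` Selmer, `2^k • t = 0`, vanishing over a square-free `n′` of Zhang–Kolyvagin
primes of index `≥ L`, `τ_* t = −(ε_n • t)`.  Then `B_{2^k}(x, x′) = 0`. (Proof adapted verbatim from gk2-p5 g27.)
[cite: McCallumLMS1991, §4 Lemma 4.3, Prop. 4.7, §5 Lemma 5.3, Thm. 5.4] [cite: GrossLMS1991, Prop. 5.4, Prop. 6.2 (1)]
[cite: MilneADT2006, Ch. I §6, proof of Prop. 6.9] [cite: DokchitserDokchitserMathZ2012, Theorem (1)] -/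
theorem ctLevelPairing_eq_zero_of_kolyvaginClass_of_opposite_sign_transposition [NeZero (W.conductorNorm ℤ)]
    (hK : IsImaginaryQuadratic K) (hodd' : Odd (NumberField.discr K)) (hne3 : NumberField.discr K ≠ -3)
    (hH : SatisfiesHeegnerHypothesis (W.conductorNorm ℤ) K) (hodd : Odd W.tamagawaProduct)
    (hρ2 : W.HasSurjectiveModNGaloisRep 2) {τ : K ≃ₐ[ℚ] K} (hτ1 : τ ≠ 1)
    (Dt : ModularParametrizationData W (W.conductorNorm ℤ)) (β : ℤ) (ι : K →+* ℂ)
    {L k : ℕ} (hLk : L = 2 * k) (hk1 : 1 ≤ k) [NeZero (2 ^ k)] [NeZero (2 ^ k * 2 ^ k)]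
    (e : (W.baseChange K).geomTorsion ((2 ^ k * 2 ^ k : ℕ) : ℤ) → (W.baseChange K).geomTorsion ((2 ^ k * 2 ^ k : ℕ) : ℤ) →
      AlgebraicClosure K)
    (hμ : ∀ S T, e S T ^ (2 ^ k * 2 ^ k) = 1)
    (hadd₁ : ∀ S₁ S₂ T, e (S₁ + S₂) T = e S₁ T * e S₂ T)
    (hadd₂ : ∀ S T₁ T₂, e S (T₁ + T₂) = e S T₁ * e S T₂)
    (hgal : ∀ (γ : absoluteGaloisGroup K) (S T : (W.baseChange K).geomTorsion ((2 ^ k * 2 ^ k : ℕ) : ℤ)),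
      γ • e S T = e (γ • S) (γ • T))
    (halt : ∀ T, e T T = 1)
    (hlift : ∀ (σ : K ≃ₐ[ℚ] K) (τ' : AlgebraicClosure K ≃+* AlgebraicClosure K) (hτ' : IsLiftOfAut σ τ')
      (S T : (W.baseChange K).geomTorsion ((2 ^ k * 2 ^ k : ℕ) : ℤ)),
      τ' (e S T) = e (hτ'.torsionMap W ((2 ^ k * 2 ^ k : ℕ) : ℤ) S) (hτ'.torsionMap W ((2 ^ k * 2 ^ k : ℕ) : ℤ) T))
    (inv : LocalInvariants K (2 ^ k * 2 ^ k)) (hinvc : inv.IsConjCompatible τ) (hPT' : inv.SumInvLocalizationEqZero)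
    (hH3 : ∀ c₃ : galoisCohomology (DiscreteGaloisModule.mu K (2 ^ k * 2 ^ k)) 3,
      (∀ v : Place K, galoisCohomology.localization (DiscreteGaloisModule.mu K (2 ^ k * 2 ^ k)) v 3 c₃ = 0) → c₃ = 0)
    (hfin : ∀ D : GeneralCaseData (W.baseChange K) (2 ^ k) e hμ hadd₁ hadd₂ hgal,
      ∃ S : Finset (Place K), ∀ v ∉ S, D.localTerm inv v = 0)
    -- the first class: a Kolyvagin class with provenance
    {n : ℕ} (hn : Squarefree n)
    (hKol : ∀ ℓ ∈ n.primeFactors, Zhang2014.IsKolyvaginPrime (W.conductorNorm ℤ) W K 2 ℓ ∧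
      L ≤ Zhang2014.kolyvaginIndex W 2 ℓ ∧
        (∃ (v : HeightOneSpectrum (𝓞 ℚ)) (𝔓 : Ideal (absIntegers (𝓞 ℚ) ℚ)) (h : absoluteGaloisGroup ℚ),
          (ℓ : 𝓞 ℚ) ∈ v.asIdeal ∧ 𝔓 ∈ v.primesAbove ∧ IsArithFrobAt (𝓞 ℚ) h 𝔓 ∧ ∃ u : geomTorsion W 2, h • u ≠ u))
    (d : KolyvaginHeegnerData Dt β ι n) {e₁ : ℕ} (he₁ : e₁ ≤ k)
    (hzS : ((2 ^ (L - e₁) : ℕ) : ℤ) • d.kolyvaginClass Nat.prime_two L ∈ selmerGroup (W.baseChange K) ((2 ^ L : ℕ) : ℤ))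
    (hzloc : ∀ ℓ ∈ n.primeFactors, ∀ v : HeightOneSpectrum (𝓞 K), (ℓ : 𝓞 K) ∈ v.asIdeal →
      ((2 ^ (L - e₁) : ℕ) : ℤ) • d.kolyvaginClass Nat.prime_two L ∈
        (W.baseChange K).torsionLocalKer (v.adicCompletion K) ((2 ^ L : ℕ) : ℤ))
    -- the second class
    {t : galH1Torsion (W.baseChange K) ((2 ^ L : ℕ) : ℤ)} (htS : t ∈ selmerGroup (W.baseChange K) ((2 ^ L : ℕ) : ℤ))
    (hkt : ((2 ^ k : ℕ) : ℤ) • t = 0)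
    {n' : ℕ} (hn' : Squarefree n')
    (hKol' : ∀ ℓ ∈ n'.primeFactors, Zhang2014.IsKolyvaginPrime (W.conductorNorm ℤ) W K 2 ℓ ∧ L ≤ Zhang2014.kolyvaginIndex W 2 ℓ)
    (htloc : ∀ ℓ ∈ n'.primeFactors, ∀ v : HeightOneSpectrum (𝓞 K), (ℓ : 𝓞 K) ∈ v.asIdeal →
      t ∈ (W.baseChange K).torsionLocalKer (v.adicCompletion K) ((2 ^ L : ℕ) : ℤ))
    (hst : conjAct W τ ((2 ^ L : ℕ) : ℤ) t = -((-W.rootNumber * (-1) ^ n.primeFactors.card) • t))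
    -- the Ш-classes over them
    (x x' : ((W.baseChange K).sha)[((2 ^ k : ℕ) : ℤ)])
    (hx : shaTorsionVal (W.baseChange K) (2 ^ k) x =
      torsionH1ToH1 (W.baseChange K) ((2 ^ L : ℕ) : ℤ) (((2 ^ (L - e₁) : ℕ) : ℤ) • d.kolyvaginClass Nat.prime_two L))
    (hx' : shaTorsionVal (W.baseChange K) (2 ^ k) x' = torsionH1ToH1 (W.baseChange K) ((2 ^ L : ℕ) : ℤ) t) :
    ctLevelPairing (W.baseChange K) (2 ^ k) e hμ hadd₁ hadd₂ hgal inv halt hPT' hH3 hfin x x' = 0 := by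
  haveI hell : (W.baseChange K).IsElliptic := inferInstanceAs ((W.map (algebraMap ℚ K)).IsElliptic)
  haveI : Fact (Nat.Prime 2) := ⟨Nat.prime_two⟩
  have hne4 : NumberField.discr K ≠ -4 := fun h ↦ by
    rw [h] at hodd'
    exact (Int.not_even_iff_odd.mpr hodd') ⟨-2, by norm_num⟩
  have hsurj1 : W.HasSurjectiveModNGaloisRep ((2 : ℤ) ^ 1) := by rwa [pow_one]
  have hL1 : 1 ≤ L := by omega
  have hL0 : (2 ^ L : ℕ) ≠ 0 := pow_ne_zero _ two_ne_zero
  have hNm : 2 ^ L = 2 ^ k * 2 ^ k := by subst hLk; rw [two_mul, pow_add]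
  have hττ : τ * τ = 1 := mul_self_eq_one_of_isImaginaryQuadratic hK τ
  have hKol₂ : ∀ ℓ ∈ n.primeFactors, Zhang2014.IsKolyvaginPrime (W.conductorNorm ℤ) W K 2 ℓ ∧
      L ≤ Zhang2014.kolyvaginIndex W 2 ℓ := fun ℓ hℓ ↦ ⟨(hKol ℓ hℓ).1, (hKol ℓ hℓ).2.1⟩
  -- no `Γ_K`-fixed point in `E[2^k]`: `E(K)[2] = 0`
  have h2K : ∀ P : (W.baseChange K).toAffine.Point, 2 • P = 0 → P = 0 :=
    forall_two_nsmul_baseChange_of_hasSurjectiveModNGaloisRep_two_of_isImaginaryQuadratic W hρ2 K hK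
  have hnofix : ∀ P : geomTorsion (W.baseChange K) ((2 ^ k : ℕ) : ℤ), (∀ g : absoluteGaloisGroup K, g • P = P) → P = 0 :=
    fun P hP ↦ VisiblePairAtTwo.geomTorsion_fixed_eq_zero_of_forall_two_nsmul (W.baseChange K) h2K k P hP
  -- the abstract data: `c = c_L(n)`, `k′ = 2^{k−e₁}`, `s = ε_n`, `Sn` / `Sn′` the places over `n` / `n′`
  set c := d.kolyvaginClass Nat.prime_two L with hcdef
  have hz : ((2 ^ (L - e₁) : ℕ) : ℤ) • c = ((2 ^ k : ℕ) : ℤ) • (((2 ^ (k - e₁) : ℕ) : ℤ) • c) := by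
    rw [smul_smul, ← natCast_two_pow_sub_eq_mul hLk he₁]
  have hsc : conjAct W τ ((2 ^ L : ℕ) : ℤ) (((2 ^ (k - e₁) : ℕ) : ℤ) • c) =
      (-W.rootNumber * (-1) ^ n.primeFactors.card) • (((2 ^ (k - e₁) : ℕ) : ℤ) • c) :=
    conjAct_two_pow_zsmul_kolyvaginClass_eq_sign_smul W K Dt β ι hK hne3 hne4 hodd' hH hsurj1 τ hτ1 hn hL1 hKol₂ d (k - e₁)
  refine ctLevelPairing_eq_zero_of_opposite_signs_of_level_eq_transposition W K hNm hNm.symm hK hL1 hτ1 hττ e hμ hadd₁ hadd₂ hgal halt inv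
    hinvc hPT' hH3 hfin hnofix x x' hzS htS hx hx' (((2 ^ (k - e₁) : ℕ) : ℤ)) hz hkt hsc hst
    {q | ((n : ℕ) : 𝓞 K) ∈ q.asIdeal} {q | ((n' : ℕ) : 𝓞 K) ∈ q.asIdeal} ?_ ?_ ?_ ?_ ?_
  · -- `c_L(n)` is Selmer off `n` at every place (Gross Prop. 6.2 (1), odd Tamagawa; complex places)
    intro v hv
    rcases v with w | q
    · rw [selmerLocalKer_completion_inl]
      exact mem_selmerLocalKer_infinitePlace_of_isImaginaryQuadratic hK _ w _
    · rw [selmerLocalKer_completion_inr]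
      exact P2.TamagawaSelmerAtTwo.kolyvaginClass_mem_selmerLocalKer_two_pow_of_not_mem d hK hH hodd hn.ne_zero L q
        fun h ↦ hv q h rfl
  · -- `2^k • loc_q (2^{k−e₁} c) = loc_q z = 0` at the places over `n`
    intro q hq
    obtain ⟨ℓ, hℓ, hℓq⟩ := (JET.SelmerVocabulary.natCast_mem_iff_exists_primeFactor_mem hn.ne_zero q).mp hq
    haveI : CharZero (q.adicCompletion K) := charZero_of_injective_algebraMap (algebraMap K (q.adicCompletion K)).injective
    have h := (mem_torsionLocalKer_iff_res_eq_zero (W.baseChange K) (q.adicCompletion K) hL0 _).mp (hzloc ℓ hℓ q hℓq)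
    rw [hz] at h
    exact (map_zsmul _ _ _).symm.trans h
  · -- `loc_q t = 0` at the places over `n′`
    intro q hq
    obtain ⟨ℓ, hℓ, hℓq⟩ := (JET.SelmerVocabulary.natCast_mem_iff_exists_primeFactor_mem hn'.ne_zero q).mp hq
    haveI : CharZero (q.adicCompletion K) := charZero_of_injective_algebraMap (algebraMap K (q.adicCompletion K)).injective
    exact (mem_torsionLocalKer_iff_res_eq_zero (W.baseChange K) (q.adicCompletion K) hL0 _).mp (htloc ℓ hℓ q hℓq)
  · -- `E[2^L] ⊂ E(K_q)` at the places over `n′` (index `≥ L`)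
    intro q hq g Q
    obtain ⟨ℓ, hℓ, hℓq⟩ := (JET.SelmerVocabulary.natCast_mem_iff_exists_primeFactor_mem hn'.ne_zero q).mp hq
    exact galoisRep_toLocal_apply_eq_self W K hK (hKol' ℓ hℓ).1 (hKol' ℓ hℓ).2 q hℓq g Q
  · -- the places over `n` are deep inert Kolyvagin places carrying the lift-equivariance of `e`
    intro q hq _
    obtain ⟨ℓ, hℓ, hℓq⟩ := (JET.SelmerVocabulary.natCast_mem_iff_exists_primeFactor_mem hn.ne_zero q).mp hq
    have hfix : τ • q = q := smul_place_eq_of_zhangKolyvaginPrime W K (hKol ℓ hℓ).1 τ hℓq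
    exact ⟨ℓ, hfix, (hKol ℓ hℓ).1, (hKol ℓ hℓ).2.1, (hKol ℓ hℓ).2.2, hℓq,
      fun S T ↦ (hlift τ _ (isLiftOfAut_liftAutPlace τ hfix) S T).symm⟩

end Summit.BirchSwinnertonDyer.BirchSwinnertonDyer.Theorems.GenusExact.PlusDescent

end
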